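import Mathlib
import Literature.MathematicalPhysics.QuantumFieldTheory.Luscher2010.TrivializingMaps
import Summits.Ventures.LatticeQCDFlow.TrivializingMaps.DefectLogWeight
import Summits.Ventures.LatticeQCDFlow.TrivializingMaps.DefectLogWeightMeasure
import HarnessLib

/-!
# Log-weight oscillation ⇒ Boltzmann density ratio: the master packaging theorem

HONEST FRAMING: exact (Metropolis-corrected) sampling algorithms for lattice gauge theory; figures of merit are
autocorrelation/cost numbers at stated couplings and volumes; no continuum-physics claim.

`DefectLogWeightMeasure.lean` proves the venture's typed target `DefectControlsLogWeight` (uniform defect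
`δ` of the trivializing-flow equation (4.5) ⇒ `(Φ₁)_* D[V] = ρ · 𝒵⁻¹e^{-S}D[U]` with `ρ(U) ≤ e^{2δ} ρ(U')`),
conditionally on the cited `FlowGlobalExistence` and `JacobianFormula` of Lüscher §3. This file factors the
measure-theoretic half of that proof into the reusable **master theorem**
`exists_density_of_logWeight_osc`: if `Φ` integrates `Z_t = -∂S̃_t` (`S̃` jointly smooth), `Φ_1` is
measurable, and the pulled-back log-weight `R(V) = ∫₀¹ div Z_s(Φ_s V) ds - S(Φ₁ V)` (`= ln det Φ_{1*}(V) -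
S(Φ₁ V)` by (3.9)) OSCILLATES BY AT MOST `M`, then `(Φ₁)_* D[V] = ρ · 𝒵⁻¹e^{-S}D[U]` with `ρ > 0` measurable
and `ρ(U) ≤ e^{M} ρ(U')`. Instances: `DefectControlsLogWeight` (`M = 2δ`, `logWeight_osc_le_of_defect`),
the truncated Lüscher map (`M = 2K/(N+2)`, `TruncatedMapLogWeight.lean`) and the exact trivializing flow
(`M = 0`, `TrivializingFlow.lean`). The proof is the one of `defectControlsLogWeight_of` with the defect
bound replaced by the oscillation hypothesis: `Ψ = Φ₁⁻¹` by backward integration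
(`exists_continuous_inverse_flowMap_one`), (3.9) at `t = 1` tested against `f · e^{-S - R∘Ψ}`
(`map_trivialMeasure_eq_withDensity`), `ρ = 𝒵 e^{-R∘Ψ}` (`withDensity_exp_neg_add_eq_boltzmann`).

References: M. Lüscher, Trivializing maps, the Wilson flow and the HMC algorithm, CMP 293 (2010) 899
[Luscher2010Trivializing, arXiv:0907.5491], §2.2 eq. (2.4), §3.1–§3.2 eq. (3.9), §4.1 eqs. (4.1)–(4.3).
-/


namespace Summit.Ventures.LatticeQCDFlow.TrivializingMaps

open MeasureTheory
open Literature.MathematicalPhysics.QuantumFieldTheory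
open Literature.MathematicalPhysics.QuantumFieldTheory.Luscher2010
open scoped Matrix Matrix.Norms.Frobenius ContDiff BoundedContinuousFunction

variable {d L n : ℕ}
/-! ## The master packaging theorem: a log-weight oscillation bound gives a Boltzmann density ratio bound -/

section Main

variable [NeZero L]

/-- `x · e^{-(a + (J - a))} · e^{J} = x`. [folklore] -/
private theorem mul_exp_neg_cancel' (x a J : ℝ) :
    x * Real.exp (-(a + (J - a))) * Real.exp J = x := by
  rw [mul_assoc, ← Real.exp_add, show -(a + (J - a)) + J = 0 by ring, Real.exp_zero, mul_one]

/-- **Master packaging theorem** (OURS, conditional on the cited `FlowGlobalExistence`, `JacobianFormula`):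
if `Φ` integrates `Z_t = -∂S̃_t` (`S̃` jointly smooth) and `R(V) = ∫₀¹ div Z_s(Φ_s V) ds - S(Φ₁ V)` (`= ln det
Φ_{1*}(V) - S(Φ₁V)` by (3.9)) oscillates by at most `M`, then `(Φ₁)_* D[V] = ρ · 𝒵⁻¹ e^{-S} D[U]`, `ρ > 0`
measurable, `ρ(U) ≤ e^{M} ρ(U')`. Proof: `Ψ = Φ₁⁻¹` by backward integration; (3.9) at `t = 1` tested against
`f · e^{-S - R∘Ψ}` gives `(Φ₁)_* D[V] = e^{-S-R∘Ψ} D[U]`; `ρ = 𝒵 e^{-R∘Ψ}`. Instances: `DefectControlsLogWeight`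
(`M = 2δ`) and `TruncatedMapLogWeightBound` (`M = 2K/(N+2)`). [cite: Luscher2010Trivializing, §3.2 eq. (3.9)] -/
theorem exists_density_of_logWeight_osc (hGE : FlowGlobalExistence d L n) (hJ : JacobianFormula d L n)
    (B : SuBasis n) {S : AmbConfig d L n → ℝ} (hS : ContDiff ℝ ∞ S) {F : ℝ → AmbConfig d L n → ℝ}
    (hF : ContDiff ℝ ∞ fun p : ℝ × AmbConfig d L n => F p.1 p.2)
    {Φ : ℝ → GaugeConfig d L (Matrix.specialUnitaryGroup (Fin n) ℂ) →
      GaugeConfig d L (Matrix.specialUnitaryGroup (Fin n) ℂ)}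
    (hΦ : IsFlowMap (fun t W => -linkGrad B (F t) W) Φ) (hmeas : Measurable (Φ 1)) {M : ℝ}
    (hosc : ∀ V V' : GaugeConfig d L (Matrix.specialUnitaryGroup (Fin n) ℂ),
      |((∫ s in (0 : ℝ)..1, linkDiv B (fun W => -linkGrad B (F s) W) (WilsonFlow.coeConfig (Φ s V))) -
          S (WilsonFlow.coeConfig (Φ 1 V))) -
        ((∫ s in (0 : ℝ)..1, linkDiv B (fun W => -linkGrad B (F s) W) (WilsonFlow.coeConfig (Φ s V'))) -
          S (WilsonFlow.coeConfig (Φ 1 V')))| ≤ M) :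
    ∃ ρ : GaugeConfig d L (Matrix.specialUnitaryGroup (Fin n) ℂ) → ℝ, Measurable ρ ∧ (∀ U, 0 < ρ U) ∧
      Measure.map (Φ 1) (trivialMeasure (Matrix.specialUnitaryGroup (Fin n) ℂ) d L) =
        (boltzmannMeasure fun U : GaugeConfig d L (Matrix.specialUnitaryGroup (Fin n) ℂ) =>
          S (WilsonFlow.coeConfig U)).withDensity (fun U => ENNReal.ofReal (ρ U)) ∧
      ∀ U U', ρ U ≤ Real.exp M * ρ U' := by
  haveI : SecondCountableTopology (Matrix (Fin n) (Fin n) ℂ) :=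
    inferInstanceAs (SecondCountableTopology (Fin n → Fin n → ℂ))
  haveI : SecondCountableTopology (Matrix.specialUnitaryGroup (Fin n) ℂ) :=
    Topology.IsEmbedding.subtypeVal.secondCountableTopology
  -- (a)+(b) the generator; `Φ` is the global flow (joint continuity); the inverse of `Φ 1`
  have hZ1 := contDiff_one_neg_linkGrad_param B hF
  have hZtan := isTangent_neg_linkGrad B F
  obtain ⟨hΦc, -⟩ := isFlowMap_continuous_unique hGE hZ1 hZtan hΦ
  have hΦ1c : Continuous (Φ 1) := hΦc.comp (continuous_const.prodMk continuous_id)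
  obtain ⟨Ψ, hΨc, hΨl, hΨr⟩ := exists_continuous_inverse_flowMap_one hGE B hF hΦ
  -- (c) the log-weight `R`
  obtain ⟨R, hR⟩ : ∃ R : GaugeConfig d L (Matrix.specialUnitaryGroup (Fin n) ℂ) → ℝ, ∀ V, R V =
      (∫ s in (0 : ℝ)..1, linkDiv B (fun W => -linkGrad B (F s) W) (WilsonFlow.coeConfig (Φ s V))) -
        S (WilsonFlow.coeConfig (Φ 1 V)) := ⟨_, fun V => rfl⟩
  have hRosc : ∀ V V', |R V - R V'| ≤ M := fun V V' => by
    rw [hR, hR]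
    exact hosc V V'
  have hS'c : Continuous fun U : GaugeConfig d L (Matrix.specialUnitaryGroup (Fin n) ℂ) =>
      S (WilsonFlow.coeConfig U) := hS.continuous.comp WilsonFlow.continuous_coeConfig
  have hRc : Continuous R := by
    have hR' : R = fun V => (∫ s in (0 : ℝ)..1, linkDiv B (fun W => -linkGrad B (F s) W)
        (WilsonFlow.coeConfig (Φ s V))) - S (WilsonFlow.coeConfig (Φ 1 V)) := funext hR
    rw [hR']
    exact (continuous_integral_linkDiv_flowMap B hF hΦc).sub (hS'c.comp hΦ1c)
  -- (d) the Jacobian formula (3.9) at `t = 1`, tested against `f · e^{-S - R∘Ψ}`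
  have hhc : Continuous fun U : GaugeConfig d L (Matrix.specialUnitaryGroup (Fin n) ℂ) =>
      Real.exp (-(S (WilsonFlow.coeConfig U) + R (Ψ U))) :=
    Real.continuous_exp.comp (hS'c.add (hRc.comp hΨc)).neg
  have key : ∀ f : GaugeConfig d L (Matrix.specialUnitaryGroup (Fin n) ℂ) →ᵇ ℝ,
      ∫ U, f U * Real.exp (-(S (WilsonFlow.coeConfig U) + R (Ψ U)))
          ∂(trivialMeasure (Matrix.specialUnitaryGroup (Fin n) ℂ) d L) =
        ∫ V, f (Φ 1 V) ∂(trivialMeasure (Matrix.specialUnitaryGroup (Fin n) ℂ) d L) := by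
    intro f
    have hO : Continuous fun U : GaugeConfig d L (Matrix.specialUnitaryGroup (Fin n) ℂ) =>
        f U * Real.exp (-(S (WilsonFlow.coeConfig U) + R (Ψ U))) := f.continuous.mul hhc
    have hJ1 : ∫ U, f U * Real.exp (-(S (WilsonFlow.coeConfig U) + R (Ψ U)))
          ∂(trivialMeasure (Matrix.specialUnitaryGroup (Fin n) ℂ) d L) =
        ∫ V, f (Φ 1 V) * Real.exp (-(S (WilsonFlow.coeConfig (Φ 1 V)) + R (Ψ (Φ 1 V)))) *
          Real.exp (∫ s in (0 : ℝ)..1, linkDiv B (fun W => -linkGrad B (F s) W)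
            (WilsonFlow.coeConfig (Φ s V))) ∂(trivialMeasure (Matrix.specialUnitaryGroup (Fin n) ℂ) d L) :=
      hJ B (fun t W => -linkGrad B (F t) W) Φ hZ1 hZtan hΦ 1 _ hO
    rw [hJ1]
    refine integral_congr_ae (Filter.Eventually.of_forall fun V => ?_)
    simp only [hΨl, hR]
    exact mul_exp_neg_cancel' _ _ _
  -- (e) identification of the pushforward; the density `ρ = 𝒵 · e^{-R∘Ψ}`
  have hmap := map_trivialMeasure_eq_withDensity hmeas hhc (fun U => (Real.exp_pos _).le) key
  obtain ⟨hZ0, hZtop⟩ := partitionFn_ne_zero_and_ne_top (d := d) (L := L) hS'c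
  refine ⟨fun U => (partitionFn fun U : GaugeConfig d L (Matrix.specialUnitaryGroup (Fin n) ℂ) =>
      S (WilsonFlow.coeConfig U)).toReal * Real.exp (-R (Ψ U)), ?_, ?_, ?_, ?_⟩
  · exact (continuous_const.mul (Real.continuous_exp.comp (hRc.comp hΨc).neg)).measurable
  · exact fun U => mul_pos (ENNReal.toReal_pos hZ0 hZtop) (Real.exp_pos _)
  · rw [hmap]
    exact withDensity_exp_neg_add_eq_boltzmann hS'c (hRc.comp hΨc)
  · intro U U'
    have h := (abs_le.1 (hRosc (Ψ U') (Ψ U))).2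
    calc (partitionFn fun U : GaugeConfig d L (Matrix.specialUnitaryGroup (Fin n) ℂ) =>
            S (WilsonFlow.coeConfig U)).toReal * Real.exp (-R (Ψ U))
        ≤ (partitionFn fun U : GaugeConfig d L (Matrix.specialUnitaryGroup (Fin n) ℂ) =>
            S (WilsonFlow.coeConfig U)).toReal * (Real.exp M * Real.exp (-R (Ψ U'))) := by
          refine mul_le_mul_of_nonneg_left ?_ ENNReal.toReal_nonneg
          rw [← Real.exp_add]
          exact Real.exp_le_exp.2 (by linarith)
      _ = Real.exp M * ((partitionFn fun U : GaugeConfig d L (Matrix.specialUnitaryGroup (Fin n) ℂ) =>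
            S (WilsonFlow.coeConfig U)).toReal * Real.exp (-R (Ψ U'))) := by ring

end Main

end Summit.Ventures.LatticeQCDFlow.TrivializingMaps
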